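import Summits.CriticalPhenomena.PercolationContinuityZ3.Theorems.PercNearOneGluingNoHeavyLowerTailIncStarWDOMPendant
import Summits.CriticalPhenomena.PercolationContinuityZ3.Theorems.PercNearOneGluingNoHeavyLowerTailIncStarTwoEdgeBernstein
import HarnessLib

/-!
# W-domination at a TWO-PRONGED root, part 1: the arithmetic core and the cluster lemma (Sahi programme, prover prim-sahi-p2 gen 34)

Support file (`--supports stmt-CriticalPhenomena-4575`).  No definitions, no named facts, no sorries; standard axioms.
Memo `run/shared/lean/prim/prim-sahi/FROM-prim-sahi-p2-gen34-WDOM.md` §6, `prim-sahi-p2/PROOF-E3.md` §44 (44e).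

**Theorem `wdom_twoPronged`.**  Let `s, i, j` be distinct and let the root `s` carry weight `0` on every non-loop pair other than `e₁ = s(s,i)`, `e₂ = s(s,j)`
(the rest of the graph is arbitrary).  Then for every up-closed family `𝒜` of vertex sets, with `A = {ω | C_s(ω) ∈ 𝒜}`, `B_v = {s ↔ v}`, `q_v = P(B_v)`:
`2·P(A ∩ B_i ∩ B_j) − q_j·P(A ∩ B_i) − q_i·P(A ∩ B_j) − (2 q_{ij} − 2 q_i q_j)·P(A) ≥ 0` — the W-domination conjecture of the memo is a theorem for
two-pronged roots.  Proof (memo §6): two-pair pinning (`EdgeInduction.real_twoBondDecomp`), the description of the cluster under the four pinned laws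
(`reach_twoPronged`), the insert-couplings `P¹¹ = P¹⁰ ∘ (insert e₂)⁻¹ = P⁰¹ ∘ (insert e₁)⁻¹`, Harris under `P¹⁰`, `P⁰¹` for `A` against
`D = {i ↔ j away from the root pairs}`, and the polynomial certificate `wdom_twoPronged_core`.
-/

noncomputable section

namespace Summit.CriticalPhenomena.PercolationContinuityZ3.Theorems

namespace IncStar

open MeasureTheory Set Literature.Probability.Percolation Literature.Probability.LatticeModels EdgeInduction
open scoped Classical

variable {n : ℕ}

/-- The real-arithmetic core of `wdom_twoPronged`: the budget certificate `S(1−u)T = …` of the memo, §6. [this work] -/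
theorem wdom_twoPronged_core (a b u A X Y M qi qj qij EW cp : ℝ)
    (hqi : qi = a + (1 - a) * b * u) (hqj : qj = b + a * (1 - b) * u) (hqij : qij = a * b + (a * (1 - b) + (1 - a) * b) * u)
    (hEWd : EW = 2 * qij - 2 * qi * qj) (hcpd : cp = 2 - qi - qj - EW)
    (ha0 : 0 ≤ a) (ha1 : a ≤ 1) (hb0 : 0 ≤ b) (hb1 : b ≤ 1) (hu0 : 0 ≤ u) (hu1 : u ≤ 1)
    (hA : 0 ≤ A) (hX : 0 ≤ X) (hY : 0 ≤ Y)
    (hH1 : u * X ≤ (1 - u) * A) (hH2 : u * Y ≤ (1 - u) * A) (hM1 : X ≤ M) (hM2 : Y ≤ M) :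
    0 ≤ cp * (a + b - a * b) * A + a * b * cp * M - a * (1 - b) * (qj + EW) * X - (1 - a) * b * (qi + EW) * Y := by
  have he : 0 ≤ (1 - a) * (1 - b) := mul_nonneg (by linarith) (by linarith)
  have hEW : EW = 2 * u * ((1 - a) * (1 - b)) * (a + b - a * b * u) := by
    rw [hEWd, hqij, hqi, hqj]; ring
  have hab1 : 0 ≤ a + b - a * b := by have : 0 ≤ a * (1 - b) := mul_nonneg ha0 (by linarith); linarith
  have hab : 0 ≤ a + b - a * b * u := by
    have : a * b * u ≤ a * b := by have := mul_le_mul_of_nonneg_left hu1 (mul_nonneg ha0 hb0); simpa using this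
    linarith
  have hEW0 : 0 ≤ EW := by rw [hEW]; exact mul_nonneg (mul_nonneg (mul_nonneg (by norm_num) hu0) he) hab
  have hqi1 : qi ≤ 1 := by
    rw [hqi]; nlinarith [mul_nonneg (mul_nonneg (by linarith : 0 ≤ 1 - a) hb0) hu0, mul_nonneg hb0 hu0]
  have hqj1 : qj ≤ 1 := by
    rw [hqj]; nlinarith [mul_nonneg (mul_nonneg ha0 (by linarith : 0 ≤ 1 - b)) hu0, mul_nonneg ha0 hu0]
  have hqi0 : 0 ≤ qi := by rw [hqi]; have : 0 ≤ (1 - a) * b * u := mul_nonneg (mul_nonneg (by linarith) hb0) hu0; linarith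
  have hqj0 : 0 ≤ qj := by rw [hqj]; have : 0 ≤ a * (1 - b) * u := mul_nonneg (mul_nonneg ha0 (by linarith)) hu0; linarith
  have hdi : qi - qij = a * (1 - b) * (1 - u) := by rw [hqi, hqij]; ring
  have hdj : qj - qij = b * (1 - a) * (1 - u) := by rw [hqj, hqij]; ring
  have hcp : cp = 2 * (1 - qi) * (1 - qj) + (qi - qij) + (qj - qij) := by rw [hcpd, hEWd]; ring
  have hcp0 : 0 ≤ cp := by
    rw [hcp, hdi, hdj]
    have : 0 ≤ 2 * (1 - qi) * (1 - qj) := by nlinarith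
    have : 0 ≤ a * (1 - b) * (1 - u) := mul_nonneg (mul_nonneg ha0 (by linarith)) (by linarith)
    have : 0 ≤ b * (1 - a) * (1 - u) := mul_nonneg (mul_nonneg hb0 (by linarith)) (by linarith)
    linarith
  obtain ⟨Di, hDi⟩ : ∃ Di : ℝ, Di = a * (1 - b) * (qj + EW) := ⟨_, rfl⟩
  obtain ⟨Dj, hDj⟩ : ∃ Dj : ℝ, Dj = (1 - a) * b * (qi + EW) := ⟨_, rfl⟩
  have hDi0 : 0 ≤ Di := by rw [hDi]; exact mul_nonneg (mul_nonneg ha0 (by linarith)) (by linarith)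
  have hDj0 : 0 ≤ Dj := by rw [hDj]; exact mul_nonneg (mul_nonneg (by linarith) hb0) (by linarith)
  obtain ⟨S, hS⟩ : ∃ S : ℝ, S = cp * (a + b - a * b) * u + a * b * cp * (1 - u) := ⟨_, rfl⟩
  -- the budget identity
  have hbudget : S - (1 - u) * (Di + Dj) = (1 - a) * (1 - b) * EW := by
    rw [hS, hDi, hDj, hcpd, hEWd, hqij, hqi, hqj]; ring
  have hS0 : 0 ≤ S - (1 - u) * Di := by
    have : S - (1 - u) * Di = (1 - a) * (1 - b) * EW + (1 - u) * Dj := by linarith [hbudget]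
    rw [this]; exact add_nonneg (mul_nonneg he hEW0) (mul_nonneg (by linarith) hDj0)
  have SS : 0 ≤ S := by linarith [hS0, mul_nonneg (by linarith : (0:ℝ) ≤ 1 - u) hDi0]
  obtain ⟨T, hT⟩ : ∃ T : ℝ, T = cp * (a + b - a * b) * A + a * b * cp * M - Di * X - Dj * Y := ⟨_, rfl⟩
  have hgoal : cp * (a + b - a * b) * A + a * b * cp * M - a * (1 - b) * (qj + EW) * X - (1 - a) * b * (qi + EW) * Y = T := by
    rw [hT, hDi, hDj]
  rw [hgoal]
  -- the certificate identity
  have key : S * (1 - u) * T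
      = cp * (a + b - a * b) * (((1 - u) * Di) * ((1 - u) * A - u * X) + (S - (1 - u) * Di) * ((1 - u) * A - u * Y))
        + a * b * cp * (1 - u) * (((1 - u) * Di) * (M - X) + (S - (1 - u) * Di) * (M - Y))
        + S * ((1 - a) * (1 - b) * EW) * Y := by
    rw [← hbudget, hT, hS]
    ring
  have hRHS : 0 ≤ S * (1 - u) * T := by
    rw [key]
    have t1 : 0 ≤ ((1 - u) * Di) * ((1 - u) * A - u * X) := mul_nonneg (mul_nonneg (by linarith) hDi0) (by linarith)
    have t2 : 0 ≤ (S - (1 - u) * Di) * ((1 - u) * A - u * Y) := mul_nonneg hS0 (by linarith)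
    have t3 : 0 ≤ ((1 - u) * Di) * (M - X) := mul_nonneg (mul_nonneg (by linarith) hDi0) (by linarith)
    have t4 : 0 ≤ (S - (1 - u) * Di) * (M - Y) := mul_nonneg hS0 (by linarith)
    have c1 : 0 ≤ cp * (a + b - a * b) := mul_nonneg hcp0 hab1
    have c2 : 0 ≤ a * b * cp * (1 - u) := mul_nonneg (mul_nonneg (mul_nonneg ha0 hb0) hcp0) (by linarith)
    have t5 : 0 ≤ S * ((1 - a) * (1 - b) * EW) * Y := mul_nonneg (mul_nonneg SS (mul_nonneg he hEW0)) hY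
    have := add_nonneg (add_nonneg (mul_nonneg c1 (add_nonneg t1 t2)) (mul_nonneg c2 (add_nonneg t3 t4))) t5
    linarith
  have hTform : ∀ (hX0 : Di * X = 0) (hY0 : Dj * Y = 0), 0 ≤ T := by
    intro hX0 hY0
    rw [hT, hX0, hY0, sub_zero, sub_zero]
    have c1 : 0 ≤ cp * (a + b - a * b) := mul_nonneg hcp0 hab1
    have : 0 ≤ a * b * cp * M := mul_nonneg (mul_nonneg (mul_nonneg ha0 hb0) hcp0) (le_trans hX hM1)
    exact add_nonneg (mul_nonneg c1 hA) this
  -- conclude: either S(1-u) > 0, or a degenerate case where T ≥ 0 directly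
  by_cases hu : u = 1
  · have hX0 : X = 0 := by
      have h := hH1; rw [hu] at h; norm_num at h; linarith
    have hY0 : Y = 0 := by
      have h := hH2; rw [hu] at h; norm_num at h; linarith
    exact hTform (by rw [hX0, mul_zero]) (by rw [hY0, mul_zero])
  have hu' : 0 < 1 - u := by
    rcases lt_or_eq_of_le hu1 with h | h
    · linarith
    · exact absurd h hu
  by_cases hSpos : 0 < S
  · have hpos : 0 < S * (1 - u) := mul_pos hSpos hu'
    by_contra hneg
    have hneg' : T < 0 := lt_of_not_ge hneg
    have : S * (1 - u) * T < 0 := mul_neg_of_pos_of_neg hpos hneg'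
    linarith
  · have hS00 : S = 0 := le_antisymm (not_lt.1 hSpos) SS
    have h1 : (1 - u) * (Di + Dj) = (1 - u) * (Di + Dj) := rfl
    have hprod : (1 - u) * (Di + Dj) ≤ 0 := by
      have : 0 ≤ (1 - a) * (1 - b) * EW := mul_nonneg he hEW0
      linarith [hbudget]
    have hDsum : Di + Dj ≤ 0 := by
      by_contra hc
      have hc' : 0 < Di + Dj := lt_of_not_ge hc
      have : 0 < (1 - u) * (Di + Dj) := mul_pos hu' hc'
      linarith
    have hDi00 : Di = 0 := by linarith
    have hDj00 : Dj = 0 := by linarith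
    exact hTform (by rw [hDi00, zero_mul]) (by rw [hDj00, zero_mul])


/-! ### The cluster of a two-pronged root -/

/-- **Two-pronged reachability.**  If the only non-loop pairs at `s` that may be present in `ω` are `s(s,i)` and `s(s,j)`, then a vertex `y ≠ s` is
joined to `s` iff an open root pair leads to `i` (resp. `j`) and `i` (resp. `j`) is joined to `y` away from the two root pairs. [this work] -/
theorem reach_twoPronged {ω : BondConfig (Fin n)} {s i j : Fin n} (his : i ≠ s) (hjs : j ≠ s)
    (hroot : ∀ v : Fin n, v ≠ s → v ≠ i → v ≠ j → s(s, v) ∉ ω) {y : Fin n} (hy : y ≠ s) :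
    (openGraph ω).Reachable s y ↔
      (s(s, i) ∈ ω ∧ (openGraph (ω \ {s(s, i), s(s, j)})).Reachable i y) ∨
        (s(s, j) ∈ ω ∧ (openGraph (ω \ {s(s, i), s(s, j)})).Reachable j y) := by
  constructor
  · intro h
    have key : ∀ z : Fin n, Relation.ReflTransGen (openGraph ω).Adj s z →
        z = s ∨ (s(s, i) ∈ ω ∧ (openGraph (ω \ {s(s, i), s(s, j)})).Reachable i z) ∨
          (s(s, j) ∈ ω ∧ (openGraph (ω \ {s(s, i), s(s, j)})).Reachable j z) := by
      intro z hz
      induction hz with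
      | refl => exact Or.inl rfl
      | @tail b c _ hbc ih =>
        rw [openGraph_adj] at hbc
        obtain ⟨hbc, hne⟩ := hbc
        by_cases hp1 : s(b, c) = s(s, i)
        · -- a root pair: `{b,c} = {s,i}`
          have h1 : s(s, i) ∈ ω := hp1 ▸ hbc
          rw [Sym2.eq_iff] at hp1
          rcases hp1 with ⟨_, hc⟩ | ⟨_, hc⟩
          · subst hc; exact Or.inr (Or.inl ⟨h1, SimpleGraph.Reachable.refl _⟩)
          · exact Or.inl hc
        by_cases hp2 : s(b, c) = s(s, j)
        · have h2 : s(s, j) ∈ ω := hp2 ▸ hbc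
          rw [Sym2.eq_iff] at hp2
          rcases hp2 with ⟨_, hc⟩ | ⟨_, hc⟩
          · subst hc; exact Or.inr (Or.inr ⟨h2, SimpleGraph.Reachable.refl _⟩)
          · exact Or.inl hc
        -- an ordinary pair, present in `ω ∖ {e₁, e₂}`
        have hmem : s(b, c) ∈ ω \ {s(s, i), s(s, j)} := by
          refine ⟨hbc, ?_⟩
          intro habs
          rcases habs with habs | habs
          · exact hp1 habs
          · exact hp2 habs
        have hadj : (openGraph (ω \ {s(s, i), s(s, j)})).Adj b c := by rw [openGraph_adj]; exact ⟨hmem, hne⟩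
        rcases ih with hb | ⟨h1, hb⟩ | ⟨h2, hb⟩
        · -- `b = s`: an open non-root pair at `s`, impossible
          subst hb
          by_cases hci : c = i
          · exact absurd (hci ▸ rfl : s(b, c) = s(b, i)) hp1
          by_cases hcj : c = j
          · exact absurd (hcj ▸ rfl : s(b, c) = s(b, j)) hp2
          exact absurd hbc (hroot c (Ne.symm hne) hci hcj)
        · exact Or.inr (Or.inl ⟨h1, hb.trans hadj.reachable⟩)
        · exact Or.inr (Or.inr ⟨h2, hb.trans hadj.reachable⟩)
    rw [SimpleGraph.reachable_iff_reflTransGen] at h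
    rcases key y h with h0 | h0
    · exact absurd h0 hy
    · exact h0
  · have hsub : ω \ {s(s, i), s(s, j)} ⊆ ω := fun _ hf => hf.1
    rintro (⟨h1, hr⟩ | ⟨h2, hr⟩)
    · have hadj : (openGraph ω).Adj s i := by rw [openGraph_adj]; exact ⟨h1, his.symm⟩
      exact hadj.reachable.trans (hr.mono (openGraph_mono hsub))
    · have hadj : (openGraph ω).Adj s j := by rw [openGraph_adj]; exact ⟨h2, hjs.symm⟩
      exact hadj.reachable.trans (hr.mono (openGraph_mono hsub))


/-! ### The two-pronged theorem -/

/-- Inserting a pair does not change the configuration away from the root pairs when the pair is one of them. [folklore] -/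
theorem insert_diff_rootPairs {e₁ e₂ e : Sym2 (Fin n)} (he : e = e₁ ∨ e = e₂) (ω : BondConfig (Fin n)) :
    insert e ω \ {e₁, e₂} = ω \ {e₁, e₂} := by
  ext f
  constructor
  · rintro ⟨hf, hnot⟩
    rcases Set.mem_insert_iff.1 hf with hfe | hfω
    · exfalso; apply hnot; subst hfe; rcases he with h | h
      · exact Or.inl h
      · exact Or.inr h
    · exact ⟨hfω, hnot⟩
  · rintro ⟨hf, hnot⟩
    exact ⟨Set.mem_insert_of_mem _ hf, hnot⟩


/-! ### Small tools for the pinned laws -/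

/-- The doubly pinned weight, evaluated. [folklore] -/
theorem pin₂_update_apply (w : Sym2 (Fin n) → unitInterval) {e₁ e₂ : Sym2 (Fin n)} (hne : e₁ ≠ e₂) (x y : unitInterval) (f : Sym2 (Fin n)) :
    Function.update (Function.update w e₁ x) e₂ y f = if f = e₂ then y else if f = e₁ then x else w f := by
  by_cases h2 : f = e₂
  · subst h2; simp
  · by_cases h1 : f = e₁
    · subst h1; simp [h2]
    · simp [h1, h2]

/-- Insert-coupling `P¹¹(X) = P¹⁰((insert e₂)⁻¹ X)`. [folklore] -/
theorem pin₂_real_one_one_eq_one_zero (w : Sym2 (Fin n) → unitInterval) (e₁ e₂ : Sym2 (Fin n)) (X : Set (BondConfig (Fin n))) :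
    (pin₂ w e₁ e₂ 1 1).real X = (pin₂ w e₁ e₂ 1 0).real ((fun ω : BondConfig (Fin n) => insert e₂ ω) ⁻¹' X) := by
  have hmeas : Measurable fun ω : BondConfig (Fin n) => insert e₂ ω := by
    refine measurable_set_iff.2 fun t => ?_
    simp only [Set.mem_insert_iff]
    exact measurable_const.or (measurable_set_mem t)
  have hmap := goodStepEI_prodBernoulli_map_insert (Function.update (Function.update w e₁ 1) e₂ 0) e₂
  rw [Function.update_idem] at hmap
  rw [pin₂, pin₂, ← hmap, measureReal_def, measureReal_def, Measure.map_apply hmeas MeasurableSet.of_discrete]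

/-- Insert-coupling `P¹¹(X) = P⁰¹((insert e₁)⁻¹ X)`. [folklore] -/
theorem pin₂_real_one_one_eq_zero_one (w : Sym2 (Fin n) → unitInterval) {e₁ e₂ : Sym2 (Fin n)} (hne : e₁ ≠ e₂) (X : Set (BondConfig (Fin n))) :
    (pin₂ w e₁ e₂ 1 1).real X = (pin₂ w e₁ e₂ 0 1).real ((fun ω : BondConfig (Fin n) => insert e₁ ω) ⁻¹' X) := by
  have hmeas : Measurable fun ω : BondConfig (Fin n) => insert e₁ ω := by
    refine measurable_set_iff.2 fun t => ?_
    simp only [Set.mem_insert_iff]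
    exact measurable_const.or (measurable_set_mem t)
  have hmap := goodStepEI_prodBernoulli_map_insert (Function.update (Function.update w e₁ 0) e₂ 1) e₁
  have hw : Function.update (Function.update (Function.update w e₁ 0) e₂ 1) e₁ 1 = Function.update (Function.update w e₁ 1) e₂ 1 := by
    rw [Function.update_comm hne, Function.update_idem, Function.update_comm hne.symm]
  rw [hw] at hmap
  rw [pin₂, pin₂, ← hmap, measureReal_def, measureReal_def, Measure.map_apply hmeas MeasurableSet.of_discrete]

/-- Two-pronged root: membership in `{s ↔ i}`. [this work] -/
theorem mem_openConn_left_twoPronged {ω : BondConfig (Fin n)} {s i j : Fin n} (his : i ≠ s) (hjs : j ≠ s)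
    (hroot : ∀ v : Fin n, v ≠ s → v ≠ i → v ≠ j → s(s, v) ∉ ω) :
    ω ∈ (openConn s i : Set (BondConfig (Fin n))) ↔
      s(s, i) ∈ ω ∨ (s(s, j) ∈ ω ∧ (openGraph (ω \ {s(s, i), s(s, j)})).Reachable i j) := by
  have h := reach_twoPronged (ω := ω) his hjs hroot his
  simp only [openConn, Set.mem_setOf_eq]
  rw [h]
  constructor
  · rintro (⟨h1, _⟩ | ⟨h2, hr⟩)
    · exact Or.inl h1
    · exact Or.inr ⟨h2, hr.symm⟩
  · rintro (h1 | ⟨h2, hr⟩)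
    · exact Or.inl ⟨h1, SimpleGraph.Reachable.refl _⟩
    · exact Or.inr ⟨h2, hr.symm⟩

/-- Two-pronged root: membership in `{s ↔ j}`. [this work] -/
theorem mem_openConn_right_twoPronged {ω : BondConfig (Fin n)} {s i j : Fin n} (his : i ≠ s) (hjs : j ≠ s)
    (hroot : ∀ v : Fin n, v ≠ s → v ≠ i → v ≠ j → s(s, v) ∉ ω) :
    ω ∈ (openConn s j : Set (BondConfig (Fin n))) ↔
      s(s, j) ∈ ω ∨ (s(s, i) ∈ ω ∧ (openGraph (ω \ {s(s, i), s(s, j)})).Reachable i j) := by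
  have h := reach_twoPronged (ω := ω) his hjs hroot hjs
  simp only [openConn, Set.mem_setOf_eq]
  rw [h]
  constructor
  · rintro (⟨h1, hr⟩ | ⟨h2, _⟩)
    · exact Or.inr ⟨h1, hr⟩
    · exact Or.inl h2
  · rintro (h2 | ⟨h1, hr⟩)
    · exact Or.inr ⟨h2, SimpleGraph.Reachable.refl _⟩
    · exact Or.inl ⟨h1, hr⟩


/-- A non-loop root pair other than `s(s,i)`, `s(s,j)` differs from both. [folklore] -/
theorem rootPair_ne_of_ne {s i j v : Fin n} (hvi : v ≠ i) (hvj : v ≠ j) :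
    s(s, v) ≠ s(s, i) ∧ s(s, v) ≠ s(s, j) := by
  refine ⟨?_, ?_⟩
  · intro h; rw [Sym2.eq_iff] at h
    rcases h with ⟨_, h⟩ | ⟨h, h'⟩
    · exact hvi h
    · exact hvi (h'.trans h)
  · intro h; rw [Sym2.eq_iff] at h
    rcases h with ⟨_, h⟩ | ⟨h, h'⟩
    · exact hvj h
    · exact hvj (h'.trans h)

end IncStar

end Summit.CriticalPhenomena.PercolationContinuityZ3.Theorems
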